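import Summits.Ventures.PercRepro.S2TwelveEightK1NuFourTwelveTop

/-!
# PercRepro — S2: THE CASE `ν = 4` OF THE COLOOP-FREE CELL `(13, 8)`, PART (II): A RANK-`6` SET OF `12` POINTS — THE CELL SIDE (p7, gen 18; sub-claim S2)

Part (II) of the case `ν = 4` (no set of nullity `5` on `≤ 10` points): no set of nullity `7` on `≤ 13` points, but a set `V` of nullity `6`
on `≤ 12` — then `V` has exactly `12` points, rank `6`, and is a flat. The exact-rank contraction lever on `V`: a top `m`-set meets `V`
in `≥ m − 2` points, its outside part lies in `N = M ／ V` (nullity `2` on `9` points, loopless) and has rank `≤ 5 − ρ(trace)`; the only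
non-trivial outside count is the dependent pairs of `N` (`≤ 3`, the kit). The trace side by the rank classes of the `j`-subsets of `V`
(S2RankClasses: `Dep₄ ≤ I₃`, `5·R₅³ ≤ 2·Dep₄`, `15·R₆³ ≤ Dep₄`, lines `≤ 3`, planes `≤ 6` points). `#U ≤ 47887`, `#spanning ≤ 100493`,
the tail by flats at `(9, 8)` `= 4022539 / 45`, `m = 186`, ratio `0.82`. **`c025_twelve_eight_cfk1_nu_four_twelve`**.
Nothing about the cell is claimed. Axioms: standard.
The top count `#U` is the theorem of S2TwelveEightK1NuFourTwelveTop; here the spanning count, the tail by flats at `(9, 8)` and the cell inequality.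
-/

open scoped Matroid

namespace PercRepro

namespace ThmN

open Set

variable {α : Type}

/-- **Part (II) of the case `ν = 4` of the scaled coloop-free cell `(12, 8)` of `(13, 8)` at `K₁ = 10219`**: a set of nullity `6` on `≤ 12` points and none of nullity `7` on `≤ 13`, by the exact-rank lever (`#U ≤ 47887`, `m = 186`). -/
theorem c025_twelve_eight_cfk1_nu_four_twelve (M : Matroid α) [M.Finite]
    (hR : M.eRank = ((12 : ℕ) : ℕ∞)) (hn : M.E.ncard = 12 + 8)
    (hfree : ∀ e ∈ M.E, ∃ A ⊆ M.E \ {e}, e ∉ M.closure A ∧ e ∉ M.closure ((M.E \ {e}) \ A)) (hK : ∀ e, ¬ M.IsColoop e)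
    (h5 : ¬ ∃ W ⊆ M.E, W.ncard ≤ 10 ∧ W.encard = M.eRk W + 5)
    (hno13 : ¬ ∃ V ⊆ M.E, V.ncard ≤ 13 ∧ V.encard = M.eRk V + 7)
    (hV : ∃ V ⊆ M.E, V.ncard ≤ 12 ∧ V.encard = M.eRk V + 6) :
    ((phiK 13 5 - 2) / 2) * (Matroid.topCount M 12 5 : ℚ) ≤ (Matroid.midCount M 12 5 : ℚ) := by
  classical
  have hU' := c025_twelve_eight_cfk1_nu_four_twelve_top M hR hn hfree hK h5 hno13 hV
  have hd : M.E.encard = M.eRank + ((8 : ℕ) : ℕ∞) := by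
    rw [hR, ← M.ground_finite.cast_ncard_eq, hn]
    push_cast
    ring
  obtain ⟨hs3, hs4, hs5⟩ := caps_twelve_eight_cf M hd hn hfree hK
  have hEfin := M.ground_finite
  have hL0 : ∀ e ∈ M.E, ¬ M.IsLoop e := not_isLoop_of_free M hfree
  have hs : ∀ e ∈ M.E, ∀ f ∈ M.E, e ≠ f → M.eRk {e, f} = 2 := by
    intro e he f hf hef
    have h2 : (2 : ℕ∞) ≤ M.eRk {e, f} :=
      two_le_eRk_of_two_le_ncard_of_free M hfree (pair_subset he hf) (by rw [ncard_pair hef])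
    have h3 : M.eRk {e, f} ≤ 2 := by
      have := M.eRk_le_encard {e, f}
      rwa [encard_pair hef] at this
    exact le_antisymm h3 h2
  have hC1 : ∀ L ⊆ M.E, M.eRk L = 2 → L.ncard ≤ 3 :=
    fun L hL hr => ncard_le_three_of_eRk_two M hs hfree hL hr
  have hflat : ∀ X ⊆ M.E, M.eRk X ≤ 5 → X.ncard ≤ 9 := fun X hX hr => by
    have := S2.ncard_le_of_eRk_le_of_not_nullity M 5 10 (by norm_num) h5 hX (r := 5) (by norm_num) (by exact_mod_cast hr)
    omega
  have hflat' : ∀ X ⊆ M.E, M.eRk X ≤ 4 → X.ncard ≤ 8 := fun X hX hr => by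
    have := S2.ncard_le_of_eRk_le_of_not_nullity M 5 10 (by norm_num) h5 hX (r := 4) (by norm_num) (by exact_mod_cast hr)
    omega
  -- the set `V`: nullity `6` on `≤ 12` points, hence `12` points of rank `6`, a flat
  obtain ⟨V, hV, hVn, hVk⟩ := hV
  have hVfin0 : V.Finite := hEfin.subset hV
  have hVne : M.eRk V ≠ ⊤ := ((M.eRk_le_encard V).trans_lt hVfin0.encard_lt_top).ne
  obtain ⟨r, hr0⟩ := ENat.ne_top_iff_exists.1 hVne
  have hVr : V.ncard = r + 6 := by
    have h := hVk
    rw [← hr0, ← hVfin0.cast_ncard_eq] at h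
    exact_mod_cast h
  have hr6 : r = 6 := by
    by_contra hne
    have hr5 : r ≤ 5 := by omega
    have h5' : M.eRk V ≤ 5 := by rw [← hr0]; exact_mod_cast hr5
    have h9 := hflat V hV h5'
    have hr4 : M.eRk V ≤ 4 := by rw [← hr0]; exact_mod_cast (by omega : r ≤ 4)
    have h8 := hflat' V hV hr4
    have hr3 : M.eRk V ≤ 3 := by rw [← hr0]; exact_mod_cast (by omega : r ≤ 3)
    have h6' := ncard_le_six_of_eRk_le_three_of_free M hfree hV hr3
    have hr2 : M.eRk V ≤ 2 := by rw [← hr0]; exact_mod_cast (by omega : r ≤ 2)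
    have h3' := S2.ncard_le_three_of_eRk_le_two M hs hC1 hV hr2
    omega
  subst hr6
  have hw : V.ncard = 12 := hVr
  have hr : M.eRk V = ((6 : ℕ) : ℕ∞) := hr0.symm
  have hVcl : M.closure V = V := by
    refine le_antisymm ?_ (M.subset_closure V hV)
    intro x hx
    by_contra hxV
    have hxE : x ∈ M.E := M.closure_subset_ground V hx
    apply hno13
    refine ⟨insert x V, Set.insert_subset hxE hV, ?_, ?_⟩
    · rw [Set.ncard_insert_of_notMem hxV hVfin0]; omega
    · rw [Set.encard_insert_of_notMem hxV, ← M.eRk_closure_eq, M.closure_insert_eq_of_mem_closure hx,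
        M.eRk_closure_eq, hVk]
      ring
  have hVE : V ⊆ M.E := hV
  have hS := S2.ncard_spanning_le_of_nullity M hVE hd hVk
  rw [hn, hw] at hS
  have hS' : {X : Set α | X ⊆ M.E ∧ M.eRk X = M.eRank}.ncard ≤ 100493 := hS.trans (by decide)
  have hA := ncard_eRk_le_five_le_flats M 12 8 (by norm_num) hR hn hfree 9 8 hflat hflat' (by norm_num) (by norm_num)
    (by norm_num) (by norm_num) 13 86 534 hs3 hs4 hs5
  have hA' : ({X : Set α | X ⊆ M.E ∧ M.eRk X ≤ 5}.ncard : ℚ) ≤ 4022539 / 45 := by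
    norm_num [Finset.sum_range_succ, Nat.choose] at hA
    linarith only [hA]
  exact c025_core_five_cell_of_counts_xqictq5g M 12 8 (by norm_num) hR hn 47887 hU' _ hA' 100493 hS'
    10219 (by norm_num) ((phiK 13 5 - 2) / 2) (by rw [phiK_thirteen_five]; norm_num) ⟨186, by norm_num, by norm_num, by norm_num⟩

end ThmN

end PercRepro
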